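import Literature.Computability.AlgebraicComplexity.MW21SingNsingComparisonProofs
import Literature.LinearAlgebra.DieudonneSingularSubspaces
import HarnessLib

/-!
# Makam–Wigderson 2021, towards Thm 1.13/1.14 by an elementary route: the maximal linear
# subspaces of `SING_{n,m}` (and of `NSING_{n,m}`)

Cell `val-lit`, seat t19 g6; brick B of the elementary route to
`makamWigderson2021_thm_1_13` / `_1_14` (sizing memo `HOME/np/NOTE-t19g6-MW21-Thm113-sizing.md`).
Source context: V. Makam, A. Wigderson, *Singular tuples of matrices is not a null cone (and the
symmetries of algebraic varieties)*, J. reine angew. Math. 780 (2021) = arXiv:1909.00857,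
Thm 1.13 (p0006:L35) and Thm 1.14 (p0006:L40). The printed proof (§9) computes the Lie algebra of
the symmetry group; the route here is NOT the printed one (disclosed): it classifies the linear
subspaces of `SING_{n,m}` of the largest dimension by Dieudonné's theorem
(`Literature/LinearAlgebra/DieudonneSingularSubspaces.lean`), which is the input of the symmetry
computation in the sibling file `MW21SymmetryGroupProofs.lean`. Honest framing: nothing here bears
on VP vs VNP, which is NOT proved.

## Contents (all PROVED; two bookkeeping definitions `tupleOf`, `kerMat`/`cokerMat`)

* `tupleOf p = {X ∈ Mat_n^m | ∀ i, X i ∈ p}` ("`ℂ^m ⊗ p`"), `finrank_tupleOf : dim = m · dim p`,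
  `tupleOf_inf`, `tupleOf_iInf`;
* `kerMat v = {A | A v = 0}`, `cokerMat w = {A | wᵀ A = 0}`, of dimension `n(n-1)` for `v, w ≠ 0`;
  `tupleOf (kerMat v) ⊆ NSING ⊆ SING` and likewise for `cokerMat`;
* **`finrank_le_of_subset_SING`**: a linear subspace `U ≤ Mat_n^m` contained in `SING_{n,m}` has
  `dim U ≤ m · n(n-1)` (each coordinate projection is a space of singular matrices — Dieudonné);
* **`exists_eq_tupleOf_of_finrank_eq`**: if moreover `dim U = m · n(n-1)` (`m ≥ 1`) then
  `U = tupleOf (kerMat v)` or `U = tupleOf (cokerMat w)` for a nonzero `v` resp. `w` (all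
  coordinate projections have dimension `n(n-1)`, `U` is their product, any two of them have a
  singular SUM hence coincide by Dieudonné's bound, and the common projection is `K_v` or `K^w` by
  Dieudonné's equality case); the same for `NSING_{n,m}` (`⊆ SING_{n,m}`).

## References

* [MakamWigderson2021] Thms 1.13, 1.14 (statements); §1.2 (`SING`, `NSING`).
* [Dieudonne1948], [Flanders1962] (the tree's `Literature.LinearAlgebra.finrank_le_of_forall_det_eq_zero`,
  `exists_forall_mem_iff_of_finrank_eq`).
-/

noncomputable section

open Module Matrix

namespace Literature.Computability.AlgebraicComplexity

namespace MakamWigderson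

variable {n m : ℕ}

/-! ### `tupleOf p = ℂ^m ⊗ p` -/

/-- The tuples all of whose components lie in a given space of matrices `p` ("`ℂ^m ⊗ p`").
[cite: MakamWigderson2021, §1.2 (bookkeeping for Thm 1.13)] -/
def tupleOf (p : Submodule ℂ (Matrix (Fin n) (Fin n) ℂ)) : Submodule ℂ (Tuple n m) where
  carrier := {X | ∀ i, X i ∈ p}
  add_mem' := fun hX hY i => p.add_mem (hX i) (hY i)
  zero_mem' := fun _ => p.zero_mem
  smul_mem' := fun c _ hX i => p.smul_mem c (hX i)

/-- Membership in `tupleOf p`. [cite: MakamWigderson2021, §1.2 (bookkeeping for Thm 1.13)] -/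
theorem mem_tupleOf {p : Submodule ℂ (Matrix (Fin n) (Fin n) ℂ)} {X : Tuple n m} :
    X ∈ tupleOf (m := m) p ↔ ∀ i, X i ∈ p := Iff.rfl

/-- `tupleOf p ≅ p^m`. [cite: MakamWigderson2021, §1.2 (bookkeeping for Thm 1.13)] -/
def tupleOfEquiv (p : Submodule ℂ (Matrix (Fin n) (Fin n) ℂ)) :
    tupleOf (m := m) p ≃ₗ[ℂ] (Fin m → p) where
  toFun X i := ⟨(X : Tuple n m) i, X.2 i⟩
  map_add' X Y := by ext; rfl
  map_smul' c X := by ext; rfl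
  invFun f := ⟨fun i => (f i : Matrix (Fin n) (Fin n) ℂ), fun i => (f i).2⟩
  left_inv X := by rfl
  right_inv f := by rfl

/-- `dim (ℂ^m ⊗ p) = m · dim p`. [cite: MakamWigderson2021, §1.2 (bookkeeping for Thm 1.13)] -/
theorem finrank_tupleOf (p : Submodule ℂ (Matrix (Fin n) (Fin n) ℂ)) :
    finrank ℂ (tupleOf (m := m) p) = m * finrank ℂ p := by
  rw [(tupleOfEquiv p).finrank_eq, Module.finrank_pi_fintype, Finset.sum_const, Finset.card_univ,
    Fintype.card_fin, smul_eq_mul]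

/-- `tupleOf` commutes with `⊓`. [cite: MakamWigderson2021, §1.2 (bookkeeping for Thm 1.13)] -/
theorem tupleOf_inf (p q : Submodule ℂ (Matrix (Fin n) (Fin n) ℂ)) :
    tupleOf (m := m) (p ⊓ q) = tupleOf p ⊓ tupleOf q := by
  ext X
  simp only [mem_tupleOf, Submodule.mem_inf]
  exact ⟨fun h => ⟨fun i => (h i).1, fun i => (h i).2⟩, fun h i => ⟨h.1 i, h.2 i⟩⟩

/-- `tupleOf` commutes with arbitrary infima. [cite: MakamWigderson2021, §1.2 (bookkeeping for Thm 1.13)] -/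
theorem tupleOf_iInf {ι : Sort*} (p : ι → Submodule ℂ (Matrix (Fin n) (Fin n) ℂ)) :
    tupleOf (m := m) (⨅ k, p k) = ⨅ k, tupleOf (p k) := by
  ext X
  simp only [mem_tupleOf, Submodule.mem_iInf]
  exact ⟨fun h k i => h i k, fun h i k => h k i⟩

/-- `tupleOf` is monotone. [cite: MakamWigderson2021, §1.2 (bookkeeping for Thm 1.13)] -/
theorem tupleOf_mono {p q : Submodule ℂ (Matrix (Fin n) (Fin n) ℂ)} (h : p ≤ q) :
    tupleOf (m := m) p ≤ tupleOf q := fun _ hX i => h (hX i)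

/-- `tupleOf` is injective for `m ≥ 1`. [cite: MakamWigderson2021, §1.2 (bookkeeping for Thm 1.13)] -/
theorem le_of_tupleOf_le (hm : 1 ≤ m) {p q : Submodule ℂ (Matrix (Fin n) (Fin n) ℂ)}
    (h : tupleOf (m := m) p ≤ tupleOf q) : p ≤ q := by
  intro A hA
  have : (fun _ : Fin m => A) ∈ tupleOf (m := m) p := fun _ => hA
  exact h this ⟨0, hm⟩

/-! ### `K_v = {A | A v = 0}` and `K^w = {A | wᵀ A = 0}` -/

/-- `K_v = {A ∈ M_n(ℂ) | A v = 0}`. [cite: Dieudonne1948, main theorem (the extremal spaces)] -/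
def kerMat (v : Fin n → ℂ) : Submodule ℂ (Matrix (Fin n) (Fin n) ℂ) where
  carrier := {A | A *ᵥ v = 0}
  add_mem' := fun {A B} hA hB => by
    simp only [Set.mem_setOf_eq] at hA hB ⊢; rw [add_mulVec, hA, hB, add_zero]
  zero_mem' := by simp
  smul_mem' := fun c {A} hA => by
    simp only [Set.mem_setOf_eq] at hA ⊢; rw [smul_mulVec, hA, smul_zero]

/-- `K^w = {A ∈ M_n(ℂ) | wᵀ A = 0}`. [cite: Dieudonne1948, main theorem (the extremal spaces)] -/
def cokerMat (w : Fin n → ℂ) : Submodule ℂ (Matrix (Fin n) (Fin n) ℂ) where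
  carrier := {A | w ᵥ* A = 0}
  add_mem' := fun {A B} hA hB => by
    simp only [Set.mem_setOf_eq] at hA hB ⊢; rw [vecMul_add, hA, hB, add_zero]
  zero_mem' := by simp
  smul_mem' := fun c {A} hA => by
    simp only [Set.mem_setOf_eq] at hA ⊢; rw [vecMul_smul, hA, smul_zero]

/-- Membership in `K_v`. [cite: Dieudonne1948, main theorem (the extremal spaces)] -/
@[simp] theorem mem_kerMat {v : Fin n → ℂ} {A : Matrix (Fin n) (Fin n) ℂ} :
    A ∈ kerMat v ↔ A *ᵥ v = 0 := Iff.rfl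

/-- Membership in `K^w`. [cite: Dieudonne1948, main theorem (the extremal spaces)] -/
@[simp] theorem mem_cokerMat {w : Fin n → ℂ} {A : Matrix (Fin n) (Fin n) ℂ} :
    A ∈ cokerMat w ↔ w ᵥ* A = 0 := Iff.rfl

/-- `dim K_v = n(n-1)` for `v ≠ 0` (`A ↦ A v` is onto `ℂⁿ`). [cite: Dieudonne1948, main theorem (the extremal spaces)] -/
theorem finrank_kerMat {v : Fin n → ℂ} (hv : v ≠ 0) : finrank ℂ (kerMat v) = n * (n - 1) := by
  classical
  let φ : Matrix (Fin n) (Fin n) ℂ →ₗ[ℂ] (Fin n → ℂ) :=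
    { toFun := fun A => A *ᵥ v, map_add' := fun A B => add_mulVec A B v,
      map_smul' := fun c A => by rw [smul_mulVec, RingHom.id_apply] }
  have hker : kerMat v = LinearMap.ker φ := by ext A; rfl
  have hsurj : Function.Surjective φ := by
    intro y
    obtain ⟨i, hi⟩ : ∃ i, v i ≠ 0 := Function.ne_iff.1 hv
    refine ⟨Matrix.of fun a b => if b = i then y a / v i else 0, ?_⟩
    funext a
    show ((Matrix.of fun a b => if b = i then y a / v i else 0) *ᵥ v) a = y a
    simp [mulVec, dotProduct, Finset.sum_ite_eq', div_mul_cancel₀ _ hi]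
  have h1 := LinearMap.finrank_range_add_finrank_ker φ
  rw [LinearMap.range_eq_top.2 hsurj, finrank_top, Module.finrank_fin_fun,
    Module.finrank_matrix] at h1
  simp only [Fintype.card_fin, Module.finrank_self, mul_one] at h1
  rw [hker]
  have : n * n = n * (n - 1) + n := by
    cases n with
    | zero => simp
    | succ k => simp; ring
  omega

/-- `dim K^w = n(n-1)` for `w ≠ 0`. [cite: Dieudonne1948, main theorem (the extremal spaces)] -/
theorem finrank_cokerMat {w : Fin n → ℂ} (hw : w ≠ 0) : finrank ℂ (cokerMat w) = n * (n - 1) := by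
  classical
  let φ : Matrix (Fin n) (Fin n) ℂ →ₗ[ℂ] (Fin n → ℂ) :=
    { toFun := fun A => w ᵥ* A, map_add' := fun A B => vecMul_add A B w,
      map_smul' := fun c A => by rw [vecMul_smul w c A, RingHom.id_apply] }
  have hker : cokerMat w = LinearMap.ker φ := by ext A; rfl
  have hsurj : Function.Surjective φ := by
    intro y
    obtain ⟨i, hi⟩ : ∃ i, w i ≠ 0 := Function.ne_iff.1 hw
    refine ⟨Matrix.of fun a b => if a = i then y b / w i else 0, ?_⟩
    funext b
    show (w ᵥ* Matrix.of fun a b => if a = i then y b / w i else 0) b = y b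
    simp [vecMul, dotProduct, Finset.sum_ite_eq', mul_div_cancel₀ _ hi]
  have h1 := LinearMap.finrank_range_add_finrank_ker φ
  rw [LinearMap.range_eq_top.2 hsurj, finrank_top, Module.finrank_fin_fun,
    Module.finrank_matrix] at h1
  simp only [Fintype.card_fin, Module.finrank_self, mul_one] at h1
  rw [hker]
  have : n * n = n * (n - 1) + n := by
    cases n with
    | zero => simp
    | succ k => simp; ring
  omega

/-! ### `ℂ^m ⊗ K_v`, `ℂ^m ⊗ K^w` lie in `NSING ⊆ SING` -/

/-- A tuple with a common kernel vector `v ≠ 0` is in `NSING` (the line `ℂv` is shrunk to `0`).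
[cite: MakamWigderson2021, §1.2 (NSING)] -/
theorem tupleOf_kerMat_subset_NSING {v : Fin n → ℂ} (hv : v ≠ 0) :
    (tupleOf (m := m) (kerMat v) : Set (Tuple n m)) ⊆ NSING n m := by
  intro X hX
  rw [mem_NSING_iff]
  have hcover : ∀ B ∈ Set.range X, (ℂ ∙ v).map B.mulVecLin ≤ (⊥ : Submodule ℂ (Fin n → ℂ)) := by
    rintro _ ⟨i, rfl⟩
    rw [Submodule.map_le_iff_le_comap, Submodule.span_singleton_le_iff_mem, Submodule.mem_comap,
      Matrix.mulVecLin_apply, Submodule.mem_bot]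
    exact hX i
  have h1 := ncRank_le_of_cover (Set.range X) ⊥ (ℂ ∙ v) hcover
  have h2 : finrank ℂ ((Fin n → ℂ) ⧸ (ℂ ∙ v)) + 1 = n := by
    have := Submodule.finrank_quotient_add_finrank (ℂ ∙ v)
    rw [finrank_span_singleton hv, Module.finrank_fin_fun] at this
    exact this
  rw [finrank_bot, add_zero] at h1
  omega

/-- A tuple with a common left-kernel vector `w ≠ 0` is in `NSING` (everything is mapped into the
hyperplane `w^⊥`). [cite: MakamWigderson2021, §1.2 (NSING)] -/
theorem tupleOf_cokerMat_subset_NSING {w : Fin n → ℂ} (hw : w ≠ 0) :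
    (tupleOf (m := m) (cokerMat w) : Set (Tuple n m)) ⊆ NSING n m := by
  classical
  intro X hX
  rw [mem_NSING_iff]
  -- the hyperplane `w^⊥` as the kernel of `y ↦ w · y`
  let ω : (Fin n → ℂ) →ₗ[ℂ] ℂ := (dotProductEquiv ℂ (Fin n) w : Module.Dual ℂ (Fin n → ℂ))
  have hω : ∀ y, ω y = w ⬝ᵥ y := fun y => rfl
  have hcover : ∀ B ∈ Set.range X, (⊤ : Submodule ℂ (Fin n → ℂ)).map B.mulVecLin ≤ LinearMap.ker ω := by
    rintro _ ⟨i, rfl⟩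
    rintro _ ⟨y, -, rfl⟩
    rw [LinearMap.mem_ker, hω, Matrix.mulVecLin_apply, dotProduct_mulVec, (mem_cokerMat).1 (hX i),
      zero_dotProduct]
  have h1 := ncRank_le_of_cover (Set.range X) (LinearMap.ker ω) ⊤ hcover
  have hsurj : Function.Surjective ω := by
    intro c
    obtain ⟨i, hi⟩ : ∃ i, w i ≠ 0 := Function.ne_iff.1 hw
    refine ⟨Pi.single i (c / w i), ?_⟩
    rw [hω, dotProduct_single, mul_div_cancel₀ _ hi]
  have h2 : finrank ℂ (LinearMap.ker ω) + 1 = n := by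
    have := LinearMap.finrank_range_add_finrank_ker ω
    rw [LinearMap.range_eq_top.2 hsurj, finrank_top, Module.finrank_self, Module.finrank_fin_fun]
      at this
    omega
  have h3 : finrank ℂ ((Fin n → ℂ) ⧸ (⊤ : Submodule ℂ (Fin n → ℂ))) = 0 := by
    have := Submodule.finrank_quotient_add_finrank (⊤ : Submodule ℂ (Fin n → ℂ))
    rw [finrank_top] at this
    omega
  rw [h3, zero_add] at h1
  omega

/-- `ℂ^m ⊗ K_v ⊆ SING`. [cite: MakamWigderson2021, §1.2 (1)] -/
theorem tupleOf_kerMat_subset_SING {v : Fin n → ℂ} (hv : v ≠ 0) :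
    (tupleOf (m := m) (kerMat v) : Set (Tuple n m)) ⊆ SING n m :=
  (tupleOf_kerMat_subset_NSING hv).trans NSING_subset_SING

/-- `ℂ^m ⊗ K^w ⊆ SING`. [cite: MakamWigderson2021, §1.2 (1)] -/
theorem tupleOf_cokerMat_subset_SING {w : Fin n → ℂ} (hw : w ≠ 0) :
    (tupleOf (m := m) (cokerMat w) : Set (Tuple n m)) ⊆ SING n m :=
  (tupleOf_cokerMat_subset_NSING hw).trans NSING_subset_SING

/-! ### The classification of the `m·n(n-1)`-dimensional linear subspaces of `SING`

(`det_apply_eq_zero_of_mem_SING`, `det_add_eq_zero_of_mem_SING` are the tree's, from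
`MW21SingNsingComparisonProofs.lean`.) -/

/-- **Upper bound.** A linear subspace of `Mat_n^m` inside `SING_{n,m}` has dimension at most
`m · n(n-1)`: it embeds into the product of its coordinate projections, each a linear space of
singular matrices (Dieudonné). [cite: MakamWigderson2021, Thm 1.13 (elementary route, step B)] -/
theorem finrank_le_of_subset_SING (U : Submodule ℂ (Tuple n m)) (hU : (U : Set (Tuple n m)) ⊆ SING n m) :
    finrank ℂ U ≤ m * (n * (n - 1)) := by
  classical
  let Ui : Fin m → Submodule ℂ (Matrix (Fin n) (Fin n) ℂ) := fun i => U.map (LinearMap.proj i)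
  have hsing : ∀ i, ∀ A ∈ Ui i, A.det = 0 := by
    rintro i _ ⟨X, hX, rfl⟩
    exact det_apply_eq_zero_of_mem_SING (hU hX) i
  have hdim : ∀ i, finrank ℂ (Ui i) ≤ n * (n - 1) := fun i =>
    Literature.LinearAlgebra.finrank_le_of_forall_det_eq_zero (Ui i) (hsing i)
  let Ψ : U →ₗ[ℂ] (Π i, Ui i) :=
    LinearMap.pi fun i => ((LinearMap.proj i : Tuple n m →ₗ[ℂ] _) ∘ₗ U.subtype).codRestrict (Ui i)
      fun X => Submodule.mem_map_of_mem X.2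
  have hΨ : Function.Injective Ψ := by
    intro X Y h
    apply Subtype.ext
    funext i
    exact congrArg Subtype.val (congrFun h i)
  calc finrank ℂ U ≤ finrank ℂ (Π i, Ui i) := LinearMap.finrank_le_finrank_of_injective hΨ
    _ = ∑ i, finrank ℂ (Ui i) := Module.finrank_pi_fintype ℂ
    _ ≤ ∑ _i : Fin m, n * (n - 1) := Finset.sum_le_sum fun i _ => hdim i
    _ = m * (n * (n - 1)) := by simp

/-- **The extremal subspaces.** A linear subspace of `Mat_n^m` (`m ≥ 1`) inside `SING_{n,m}` of
dimension exactly `m · n(n-1)` is `ℂ^m ⊗ K_v` or `ℂ^m ⊗ K^w` for a nonzero `v` resp. `w`.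
[cite: MakamWigderson2021, Thm 1.13 (elementary route, step B)] [cite: Dieudonne1948, main theorem] -/
theorem exists_eq_tupleOf_of_finrank_eq (hm : 1 ≤ m) (U : Submodule ℂ (Tuple n m))
    (hU : (U : Set (Tuple n m)) ⊆ SING n m) (hdimU : finrank ℂ U = m * (n * (n - 1))) :
    (∃ v : Fin n → ℂ, v ≠ 0 ∧ U = tupleOf (kerMat v)) ∨
      (∃ w : Fin n → ℂ, w ≠ 0 ∧ U = tupleOf (cokerMat w)) := by
  classical
  let Ui : Fin m → Submodule ℂ (Matrix (Fin n) (Fin n) ℂ) := fun i => U.map (LinearMap.proj i)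
  have hsing : ∀ i, ∀ A ∈ Ui i, A.det = 0 := by
    rintro i _ ⟨X, hX, rfl⟩
    exact det_apply_eq_zero_of_mem_SING (hU hX) i
  have hdim : ∀ i, finrank ℂ (Ui i) ≤ n * (n - 1) := fun i =>
    Literature.LinearAlgebra.finrank_le_of_forall_det_eq_zero (Ui i) (hsing i)
  let Ψ : U →ₗ[ℂ] (Π i, Ui i) :=
    LinearMap.pi fun i => ((LinearMap.proj i : Tuple n m →ₗ[ℂ] _) ∘ₗ U.subtype).codRestrict (Ui i)
      fun X => Submodule.mem_map_of_mem X.2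
  have hΨ : Function.Injective Ψ := by
    intro X Y h
    apply Subtype.ext
    funext i
    exact congrArg Subtype.val (congrFun h i)
  have hpi : finrank ℂ (Π i, Ui i) = ∑ i, finrank ℂ (Ui i) := Module.finrank_pi_fintype ℂ
  have hle := LinearMap.finrank_le_finrank_of_injective hΨ
  have hsum_le : ∑ i, finrank ℂ (Ui i) ≤ ∑ _i : Fin m, n * (n - 1) :=
    Finset.sum_le_sum fun i _ => hdim i
  have hconst : ∑ _i : Fin m, n * (n - 1) = m * (n * (n - 1)) := by simp
  -- all coordinate projections have the maximal dimension
  have hdim_eq : ∀ i, finrank ℂ (Ui i) = n * (n - 1) := by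
    have hsum_eq : ∑ i, finrank ℂ (Ui i) = ∑ _i : Fin m, n * (n - 1) := by
      apply le_antisymm hsum_le
      rw [hconst, ← hdimU]; rwa [hpi] at hle
    intro i
    exact (Finset.sum_eq_sum_iff_of_le fun j _ => hdim j).1 hsum_eq i (Finset.mem_univ i)
  -- `Ψ` is onto: `U` is the product of its projections
  have hfin : finrank ℂ U = finrank ℂ (Π i, Ui i) := by
    rw [hpi, hdimU, Finset.sum_congr rfl fun i _ => hdim_eq i, hconst]
  have hΨsurj : Function.Surjective Ψ :=
    (LinearMap.injective_iff_surjective_of_finrank_eq_finrank hfin).1 hΨ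
  have hprod : ∀ X : Tuple n m, (∀ i, X i ∈ Ui i) → X ∈ U := by
    intro X hX
    obtain ⟨Y, hY⟩ := hΨsurj fun i => ⟨X i, hX i⟩
    have : (Y : Tuple n m) = X := by
      funext i
      exact congrArg Subtype.val (congrFun hY i)
    rw [← this]; exact Y.2
  -- any two projections have a singular sum, hence coincide
  have hsame : ∀ i j, Ui i = Ui j := by
    suffices key : ∀ i j, i ≠ j → Ui j ≤ Ui i by
      intro i j
      by_cases hij : i = j
      · rw [hij]
      · exact le_antisymm (key j i (Ne.symm hij)) (key i j hij)
    intro i j hij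
    have hsup_sing : ∀ M ∈ Ui i ⊔ Ui j, M.det = 0 := by
      intro M hM
      obtain ⟨A, hA, B, hB, rfl⟩ := Submodule.mem_sup.1 hM
      let X : Tuple n m := fun k => if k = i then A else if k = j then B else 0
      have hXi : X i = A := by simp [X]
      have hXj : X j = B := by simp [X, Ne.symm hij]
      have hXU : X ∈ U := by
        refine hprod X fun k => ?_
        by_cases hki : k = i
        · subst hki; rw [hXi]; exact hA
        · by_cases hkj : k = j
          · subst hkj; rw [hXj]; exact hB
          · simp only [X, hki, hkj, if_false]; exact (Ui k).zero_mem
      have := det_add_eq_zero_of_mem_SING (hU hXU) i j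
      rwa [hXi, hXj] at this
    have h1 := Literature.LinearAlgebra.finrank_le_of_forall_det_eq_zero (Ui i ⊔ Ui j) hsup_sing
    have h2 : Ui i ⊔ Ui j = Ui i :=
      (Submodule.eq_of_le_of_finrank_le le_sup_left (by rw [hdim_eq i]; exact h1)).symm
    calc Ui j ≤ Ui i ⊔ Ui j := le_sup_right
      _ = Ui i := h2
  -- `U = tupleOf (Ui i₀)`
  set i₀ : Fin m := ⟨0, hm⟩
  have hU_eq : U = tupleOf (Ui i₀) := by
    ext X
    constructor
    · intro hX i
      rw [← hsame i i₀]
      exact Submodule.mem_map_of_mem (f := LinearMap.proj i) hX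
    · intro hX
      exact hprod X fun i => by rw [hsame i i₀]; exact hX i
  -- Dieudonné's equality case for `Ui i₀`
  rcases Literature.LinearAlgebra.exists_forall_mem_iff_of_finrank_eq (Ui i₀) (hsing i₀)
      (hdim_eq i₀) with ⟨v, hv, h⟩ | ⟨w, hw, h⟩
  · left
    refine ⟨v, hv, ?_⟩
    rw [hU_eq]
    congr 1
    ext A
    rw [h A, mem_kerMat]
  · right
    refine ⟨w, hw, ?_⟩
    rw [hU_eq]
    congr 1
    ext A
    rw [h A, mem_cokerMat]

/-- The same classification inside `NSING_{n,m} ⊆ SING_{n,m}` (for Thm 1.14): upper bound.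
[cite: MakamWigderson2021, Thm 1.14 (elementary route, step B)] -/
theorem finrank_le_of_subset_NSING (U : Submodule ℂ (Tuple n m))
    (hU : (U : Set (Tuple n m)) ⊆ NSING n m) : finrank ℂ U ≤ m * (n * (n - 1)) :=
  finrank_le_of_subset_SING U (hU.trans NSING_subset_SING)

/-- The same classification inside `NSING_{n,m} ⊆ SING_{n,m}` (for Thm 1.14): extremal spaces.
[cite: MakamWigderson2021, Thm 1.14 (elementary route, step B)] -/
theorem exists_eq_tupleOf_of_finrank_eq_NSING (hm : 1 ≤ m) (U : Submodule ℂ (Tuple n m))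
    (hU : (U : Set (Tuple n m)) ⊆ NSING n m) (hdimU : finrank ℂ U = m * (n * (n - 1))) :
    (∃ v : Fin n → ℂ, v ≠ 0 ∧ U = tupleOf (kerMat v)) ∨
      (∃ w : Fin n → ℂ, w ≠ 0 ∧ U = tupleOf (cokerMat w)) :=
  exists_eq_tupleOf_of_finrank_eq hm U (hU.trans NSING_subset_SING) hdimU

end MakamWigderson

end Literature.Computability.AlgebraicComplexity

end
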